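import Summits.BirchSwinnertonDyer.BirchSwinnertonDyer.Theorems.ManinLocalTwoThreeCDivisionIntegralCDT
import Literature.NumberTheory.EllipticCurves.ManinConstantClassCertificateTwist
import Summits.BirchSwinnertonDyer.BirchSwinnertonDyer.Theorems.AdditiveKolyvaginRoadManinFrameTransport
import Summits.BirchSwinnertonDyer.BirchSwinnertonDyer.Theorems.EdixhovenFibreFiveSevenTwistDegreeStepFiveSeven
import Summits.BirchSwinnertonDyer.BirchSwinnertonDyer.Theorems.AdditiveKolyvaginRoadManinFrameResidueProperTwistDegree
import Summits.BirchSwinnertonDyer.BirchSwinnertonDyer.Theses.EdixhovenFibreFiveSeven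
import Summits.BirchSwinnertonDyer.Rank1Residual.X2.IsogenyClassStability
import Literature.NumberTheory.Automorphic.ShimuraCurveRibetTakahashiOptimalModularityProofs
import Literature.NumberTheory.EllipticCurves.IsogenyIdProofs
import HarnessLib

/-!
# Route `EdixhovenFibreFiveSeven`: K★ (22226), KP57 (23810), TDS57 (22227), TDS11 (22228) BY NAME, MODULO THE PRINTED
# CALEGARI–DIMITROV–TANG **THEOREM 1 VERBATIM** (rational-integer coefficients) — not Remarks 58–59 — `--supports` 22226

Cell `pub/bsd-wall`, seat `bsd-line-edix-p1` g36 (LEAD lineage of K★'s line `kato-lever`; route DORMANT, no seat holds these items).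
THEOREMS ONLY (no definition, no named fact, no instance, no `sorry`); nothing is closed by name; BSD is not proved; Manin's conjecture
is not proved; no Manin theorem is announced.

WHY. Every landed «⟸ CDT» closer of this route and of its siblings (`TeichmullerTwistDescent.not_dvd_c_of_CDT` p769544,
`AdditiveKolyOfCDT.exists_datum_not_dvd_c_of_CDT` p769664, `EdixhovenFibreFiveSevenOfCDT.*` p769777, `TwistDegreeStepsOfCDT.*` p811276/p811277)
is keyed on the vendored ALGEBRAIC-INTEGER fact `CalegariDimitrovTang2025_unboundedDenominators_algInt` (= the paper's Remark 58 / Remark 59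
reading), because they run over the cell bsd-f2-manin's `CDivisionUDC.abs_maninConstant_eq_one_of_CDT_of_odd_sq_dvd`. That cell has since
re-run its `c`-division chain from the vendored **Theorem 1 as printed** (`CalegariDimitrovTang2025_unboundedDenominators`, `f ∈ ℤ⟦q^{1/N}⟧`,
holomorphic-at-the-cusps case): `ManinLocalTwoThree.CDivisionInt.abs_maninConstant_eq_one_of_CDTInt_of_odd_sq_dvd` (the witness
`F = 12·℘_{Λ_W}(ℰ_f)·G·Δ^a` has RATIONAL-INTEGER `q`-coefficients — Honda at the multiplier `1`). This file re-keys the EF57 Manin side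
on it. Since `CalegariDimitrovTang2025_unboundedDenominators_of_algInt : …_algInt → …` (Literature), every theorem below is STRONGER than
its `_of_CDT` twin (§4 records the implication for K★).

* §1 `not_dvd_c_of_CDTInt` — `p ∤ c(D)` at EVERY lattice-optimal datum (any level) of every globally minimal curve additive at `p ≥ 5`,
  modulo Theorem 1 (`sq_dvd_level_of_addv'` = the sibling's `TeichmullerTwistDescent.sq_dvd_level_of_addv`, repeated to stay out of that route's cone, + the integer chain); `exists_datum_not_dvd_c_of_CDTInt` — modulo
  Theorem 1 and modularity, a conductor-level datum with `p ∤ c` on every such curve with `E[p]` irreducible (optimal member, Knapp 12.9(a),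
  prime-to-`p` transport: the proof of `AdditiveKolyOfCDT.exists_datum_not_dvd_c_of_CDT` verbatim with the key swapped).
* §2 **K★ `StarredOptimalManinUnitFiveSeven` (22226) ⟸ Theorem 1**; KP57 (23810) ⟸ Theorem 1 ∧ modularity.
* §3 TDS57 (22227) and TDS11 (22228) ⟸ Theorem 1 (modularity is their own first binder), as in `TwistDegreeStepsOfCDT`.
* §4 the `_algInt` reading implies each (recorded for K★).

HONEST STATUS: CONDITIONAL on the cite-only printed fact `Literature.NumberTheory.Automorphic.CalegariDimitrovTang2025_unboundedDenominators`
(Calegari–Dimitrov–Tang, J. Amer. Math. Soc. 38 (2025), Theorem 1; statement-only in the tree); the items stay OPEN by name. BSD is not proved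
by this. [cite: CalegariDimitrovTang2025, Thm. 1] [cite: LingOesterle1991, Thm. 6] [cite: Honda1970, Thm. 9] [cite: EdixhovenManin1991, Thm. 3 and §4]
[cite: Knapp1993, Prop. 12.9(a)] [cite: ZagierCMB1985, §1 (p. 374)]
-/

set_option autoImplicit false
-- the Theorems namespace of a single-conjunct summit repeats the summit name by design (D-0017)
set_option linter.dupNamespace false

noncomputable section

open scoped Classical

open WeierstrassCurve Literature.NumberTheory.EllipticCurves Literature.NumberTheory.EllipticCurves.ModularForms
  Literature.NumberTheory.EllipticCurves.Rank1Residual Literature.NumberTheory.Automorphic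
  Summit.BirchSwinnertonDyer.Rank1Residual Summit.BirchSwinnertonDyer.Rank1Residual.Additive
  Summit.BirchSwinnertonDyer.BirchSwinnertonDyer.Theses.EdixhovenFibreFiveSeven
  Summit.BirchSwinnertonDyer.BirchSwinnertonDyer.Theorems
  Summit.BirchSwinnertonDyer.BirchSwinnertonDyer.Theorems.ManinLocalTwoThree

namespace Summit.BirchSwinnertonDyer.BirchSwinnertonDyer.Theorems.EdixhovenFibreFiveSevenOfCDTInt

/-! ### §1 Manin's `p`-part at a lattice-optimal datum, and a Manin-unit conductor-level datum, modulo Theorem 1 -/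

/-- **`p² ∣ N` for the level of ANY parametrisation datum of a curve additive at `p ≥ 5`, WITHOUT modularity** — the statement and
proof of `TeichmullerTwistDescent.sq_dvd_level_of_addv` (p769544), repeated here so that this file does not import the sibling route's
cone: `p² ∣ N_W`, so `p ∣ N` (`IsNewformOf.dvd_level_iff_dvd_conductorNorm`); if `p² ∤ N` then `a_p(f)² = 1` (Atkin–Lehner at `p ∥ N`),
but `a_p(f) = a_p(W) = 0` at an additive prime. [cite: AtkinLehner1970, Thm. 3] [cite: SilvermanAEC2009, App. C §16] -/
theorem sq_dvd_level_of_addv' {W : WeierstrassCurve ℚ} [W.IsElliptic] {N : ℕ} [NeZero N]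
    (D : ModularParametrizationData W N) {p : ℕ} [Fact p.Prime] (hadd : Addv W p) : p ^ 2 ∣ N := by
  have hp : p.Prime := Fact.out
  have hW : p ^ 2 ∣ W.conductorNorm ℤ := sq_dvd_conductorNorm_of_not_good_of_not_mult hadd
  have hpW : p ∣ W.conductorNorm ℤ := dvd_trans (dvd_pow_self p two_ne_zero) hW
  have hpN : p ∣ N := (D.isNewformOf.dvd_level_iff_dvd_conductorNorm hp).mpr hpW
  by_contra h2
  have h1 := D.isNewformOf.1.cuspCoeff_sq_eq_one_of_dvd_of_not_sq_dvd hp hpN h2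
  have h0 : cuspCoeff D.f p = 0 := by
    rw [D.isNewformOf.2 p]
    have := W.LFunction_apply_eq_zero_of_hasAdditiveReductionAt
      (Summit.BirchSwinnertonDyer.Rank1Residual.Additive.primesEquiv_symm_apply_coe p)
      (Summit.BirchSwinnertonDyer.Rank1Residual.Additive.hasAdditiveReductionAt_of_addv W p hadd) dvd_rfl
    exact_mod_cast this
  rw [h0] at h1
  norm_num at h1

/-- **Manin's `p`-part at EVERY lattice-optimal datum, MODULO CDT THEOREM 1 (integer coefficients) ONLY.** For `W/ℚ` globally minimal,
additive at a prime `p ≥ 5`, and `D` a lattice-optimal datum (`Λ_W = c·Λ_f`) at any level `N`: `p ∤ c(D)` — `p² ∣ N`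
(`sq_dvd_level_of_addv'`, unconditional) and `|c| = 1` at a level with an odd square factor
(`CDivisionInt.abs_maninConstant_eq_one_of_CDTInt_of_odd_sq_dvd`). Strictly stronger than `TeichmullerTwistDescent.not_dvd_c_of_CDT`
(hypothesis `_algInt`). CONDITIONAL on `hCDT`; nothing closed; Manin's conjecture and BSD are not proved by this.
[cite: CalegariDimitrovTang2025, Thm. 1] [cite: LingOesterle1991, Thm. 6] -/
theorem not_dvd_c_of_CDTInt (hCDT : CalegariDimitrovTang2025_unboundedDenominators)
    {W : WeierstrassCurve ℚ} [W.IsElliptic] [W.IsGloballyMinimal] {N : ℕ} [NeZero N]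
    (D : ModularParametrizationData W N) {p : ℕ} [Fact p.Prime] (hp5 : 5 ≤ p) (hadd : Addv W p)
    (hlat : ∀ z ∈ D.L.lattice, ∃ w ∈ periodLattice D.f, z = D.c * w) : ¬ (p : ℤ) ∣ D.c :=
  CDivisionNeron.not_prime_dvd_of_abs_eq_one
    (CDivisionInt.abs_maninConstant_eq_one_of_CDTInt_of_odd_sq_dvd hCDT D hlat (Fact.out : p.Prime) (by omega)
      (sq_dvd_level_of_addv' D hadd)) Fact.out

/-- **A conductor-level datum with `p ∤ c` on every globally minimal `W/ℚ` additive at `p ≥ 5` with `E[p]` irreducible, MODULO CDT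
THEOREM 1 and modularity** — the proof of `AdditiveKolyOfCDT.exists_datum_not_dvd_c_of_CDT` verbatim with the key swapped: an optimal member
`W₀ ∼ W` with a degree-minimal (hence lattice-optimal, Knapp 12.9(a)) datum at level `N(W)`, `p ∤ c` there by `not_dvd_c_of_CDTInt`,
transported to `W` prime-to-`p`. CONDITIONAL on `hCDT`, `hnf`; nothing closed. [cite: CalegariDimitrovTang2025, Thm. 1]
[cite: Knapp1993, Prop. 12.9(a)] [cite: BCDTJAMS2001, Thm. A] -/
theorem exists_datum_not_dvd_c_of_CDTInt (hCDT : CalegariDimitrovTang2025_unboundedDenominators) (hnf : exists_isNewformOf)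
    (W : WeierstrassCurve ℚ) [W.IsElliptic] [W.IsGloballyMinimal] (p : ℕ) [Fact p.Prime]
    [NeZero (W.conductorNorm ℤ)] (hp5 : 5 ≤ p) (hadd : Addv W p) (hirr : Irr W p) :
    ∃ Dt : ModularParametrizationData W (W.conductorNorm ℤ), ¬ (p : ℤ) ∣ Dt.c := by
  obtain ⟨W₀, hW₀, hW₀min, D₀, _hfW, hiso, hmin⟩ :=
    exists_optimal_modularParametrizationData_of_modularity hnf (W.conductorNorm ℤ) W rfl
  haveI := hW₀
  haveI := hW₀min
  have hlat : ∀ z ∈ D₀.L.lattice, ∃ w ∈ periodLattice D₀.f, z = D₀.c * w :=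
    D₀.latticeEq_of_forall_modularDegree_le hmin
  have hadd₀ : Addv W₀ p := (X2.addv_iff_of_isIsogenous hiso).mp hadd
  have hc₀ : ¬ (p : ℤ) ∣ D₀.c := not_dvd_c_of_CDTInt hCDT D₀ hp5 hadd₀ hlat
  exact ManinFrameTransport.exists_modularParametrizationData_not_dvd_of_partner W Fact.out hirr hiso D₀ hc₀

/-! ### §2 K★ and KP57 BY NAME, modulo Theorem 1 -/

/-- ★★★ **K★ `StarredOptimalManinUnitFiveSeven` (stmt-BirchSwinnertonDyer-22226) ⟸ CDT THEOREM 1** — the starred types IV*, III*, II* at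
`p ∈ {5, 7}`, `E[p]` irreducible, no `Iₙ*` fibre, lattice-optimal conductor-level datum ⟹ `p ∤ c`; every clause except «additive at
`p ≥ 5`» and «lattice-optimal» is idle. Strictly stronger than `EdixhovenFibreFiveSevenOfCDT.starredOptimalManinUnitFiveSeven_of_CDT`
(p769777, hypothesis `_algInt`). CONDITIONAL on `hCDT`; the item is not closed by this; BSD is not proved by this.
[cite: CalegariDimitrovTang2025, Thm. 1] [cite: EdixhovenManin1991, Thm. 3] -/
theorem starredOptimalManinUnitFiveSeven_of_CDTInt (hCDT : CalegariDimitrovTang2025_unboundedDenominators) :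
    StarredOptimalManinUnitFiveSeven := by
  intro W _ _ p _ _ D hp57 hadd _hirr _hI _hv hlat
  have hp5 : 5 ≤ p := by rcases hp57 with rfl | rfl <;> omega
  exact not_dvd_c_of_CDTInt hCDT D hp5 hadd hlat

/-- ★★ **KP57 `KPResidueManinUnitFiveSeven` (stmt-BirchSwinnertonDyer-23810) ⟸ CDT THEOREM 1 ∧ modularity** (`exists_datum_not_dvd_c_of_CDTInt`;
the Kodaira / torsion-witness / degree / `N > 5·10⁵` clauses are idle). CONDITIONAL on `hCDT`, `hnf`; the item is not closed by this;
BSD is not proved by this. [cite: CalegariDimitrovTang2025, Thm. 1] [cite: KostersPannekoek2017, Thm. 1 and Cor. 2] -/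
theorem kpResidueManinUnitFiveSeven_of_CDTInt_of_modularity (hCDT : CalegariDimitrovTang2025_unboundedDenominators)
    (hnf : exists_isNewformOf) : KPResidueManinUnitFiveSeven := by
  intro p _ V _ _ _ hp57 hadd hirr _hI _hv _htor _hall _hN
  have hp5 : 5 ≤ p := by rcases hp57 with rfl | rfl <;> omega
  exact exists_datum_not_dvd_c_of_CDTInt hCDT hnf V p hp5 hadd hirr

/-! ### §3 The twist-degree cruxes TDS57 / TDS11 BY NAME, modulo Theorem 1 -/

/-- ★★ **TDS57 `TwistDegreeStepFiveSeven` (stmt-BirchSwinnertonDyer-22227) ⟸ CDT THEOREM 1** (modularity is the item's own first binder):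
the datum of `exists_datum_not_dvd_c_of_CDTInt` fed to `TwistDegreeStepFiveSeven.twistDegreeStep57_of_not_dvd_c` (the twist identity).
Strictly stronger than `TwistDegreeStepsOfCDT.twistDegreeStepFiveSeven_of_CDT` (p811276). CONDITIONAL; the item is not closed by this.
[cite: CalegariDimitrovTang2025, Thm. 1] [cite: EdixhovenManin1991, §4 (cases 1/2)] [cite: ZagierCMB1985, §1 (p. 374)] -/
theorem twistDegreeStepFiveSeven_of_CDTInt (hCDT : CalegariDimitrovTang2025_unboundedDenominators) :
    TwistDegreeStepFiveSeven := by
  intro hnf p _ V _ _ _ Wf _ _ _ C hp57 hadd hirr hK hV4 hC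
  have hp5 : 5 ≤ p := by rcases hp57 with rfl | rfl <;> omega
  obtain ⟨D, hc⟩ := exists_datum_not_dvd_c_of_CDTInt hCDT hnf V p hp5 hadd hirr
  exact ⟨D, TwistDegreeStepFiveSeven.twistDegreeStep57_of_not_dvd_c hp5 V Wf hadd hK hV4 C hC D hc⟩

/-- ★★ **TDS11 `TwistDegreeStepOrdinary` (stmt-BirchSwinnertonDyer-22228) ⟸ CDT THEOREM 1** (modularity is the item's own first binder):
the frame curve `W` itself is the member with a Manin-unit conductor-level datum (`exists_datum_not_dvd_c_of_CDTInt`,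
`IsIsogenous.refl_holds`) wanted by `ManinFrameResidueProperTwistDegree.twistDegreeStep_of_exists_member_not_dvd_c`. Strictly stronger
than `TwistDegreeStepsOfCDT.twistDegreeStepOrdinary_of_CDT` (p811277). CONDITIONAL; the item is not closed by this.
[cite: CalegariDimitrovTang2025, Thm. 1] [cite: EdixhovenManin1991, §4 (cases 1/2)] -/
theorem twistDegreeStepOrdinary_of_CDTInt (hCDT : CalegariDimitrovTang2025_unboundedDenominators) :
    TwistDegreeStepOrdinary := by
  intro hnf W _ _ p _ _ hp11 hadd hirr _hres _hall V _ _ _ Wf _ _ _ C hisoV hG hV4 hC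
  have hp5 : 5 ≤ p := by omega
  obtain ⟨Dt, hc⟩ := exists_datum_not_dvd_c_of_CDTInt hCDT hnf W p hp5 hadd hirr
  exact ManinFrameResidueProperTwistDegree.twistDegreeStep_of_exists_member_not_dvd_c hnf W hp5 hadd hirr hisoV hG hV4 C hC
    ⟨W, ‹_›, ‹_›, Dt, IsIsogenous.refl_holds W, hc⟩

/-! ### §4 The Remark-58/59 reading implies the Theorem-1 reading (nothing landed is weakened) -/

/-- **K★ ⟸ the `_algInt` fact, THROUGH the Theorem-1 closer** — `CalegariDimitrovTang2025_unboundedDenominators_of_algInt` composes with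
`starredOptimalManinUnitFiveSeven_of_CDTInt`; so the Theorem-1 key is the weaker (better) hypothesis. Recorded for the item's bookkeeping only.
[cite: CalegariDimitrovTang2025, Thm. 1 and Remark 58] -/
theorem starredOptimalManinUnitFiveSeven_of_CDTAlgInt' (hCDT : CalegariDimitrovTang2025_unboundedDenominators_algInt) :
    StarredOptimalManinUnitFiveSeven :=
  starredOptimalManinUnitFiveSeven_of_CDTInt (CalegariDimitrovTang2025_unboundedDenominators_of_algInt hCDT)

end Summit.BirchSwinnertonDyer.BirchSwinnertonDyer.Theorems.EdixhovenFibreFiveSevenOfCDTInt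

end
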